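import Literature.Probability.RandomPlanarGeometry.SLERestrictionOneStepKappa
import Literature.Probability.RandomPlanarGeometry.SLERestrictionCompensatorKappa
import Literature.Probability.RandomPlanarGeometry.SLERestrictionIncrement
import HarnessLib

/-!
# The conditional one-step estimate for the compensated restriction martingale ([LSW] Prop. 5.3, `0 < κ ≤ 8/3`)

General-`κ` twin of `SLERestrictionIncrement` (the case `κ = 8/3`, `α = 5/8`, `λ = 0`), after

* G. F. Lawler, O. Schramm, W. Werner, *Conformal restriction: the chordal case*, J. Amer. Math.
  Soc. **16** (2003) 917–955 (**[LSW]**), §5 Prop. 5.3: for `α = (6 − κ)/(2κ)`,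
  `λ = (8 − 3κ)(6 − κ)/(2κ)`, "`Y_t = h_t′(W_t)^α exp(λ ∫₀ᵗ Sh_s(W_s)/6 ds)`, `t < T`, is a local
  martingale … If `κ ≤ 8/3`, then `Y_t` is a bounded martingale".

In conditional-increment form, with the compensator increment
`∫ᵤ^{u+h} m(A_s − W_s) ds = JFnK κ A u h` (`m = −Sh/6 ≥ 0` the Schwarzian mass of the slid hull,
`MFnK` of `SLERestrictionCompensatorKappa`): for `u ≥ 0`, a small step `h`, and an
`𝓕_u`-measurable weight `g : Ω → [0, 1]` supported where the slid hull `A_u − W_u` is in the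
controlled class (`Φ′ ≥ 2δ₀`, `B(0, 16ρ₀)` off the hull; the factor
`C_u = exp(−λ ∫₀ᵘ m) ∈ [0, 1]` of `Y_u`, being `𝓕_u`-measurable, is part of the weight),

  `|E[g · (D̂_{u+h}^α e^{−λ ∫ᵤ^{u+h} m} − Φ′_{A_u − W_u}(0)^α)]| ≤ stepCK α λ δ₀ ρ₀ · h √h`

(`abs_integral_mul_sub_leK`), `D̂_{u+h} = Φ′_{A_{u+h} − W_{u+h}}(0) 𝟙{alive at u + h}`.
Proof, as at `κ = 8/3`: freeze the past at time `u` (`integral_mul_eq_integral_integral_concat`, after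
factoring `g` through the stopped path); conditionally on the past the future driver is `W_u +` a fresh
`√κ B`; when the fresh driver oscillates little, at EVERY intermediate time `u + r`, `0 < r ≤ h`, the
hulls have not reached `A` and `A_{u+r} − W_{u+r}` is the one-step image of `B = A_u − W_u`
(`frozen_subStepK`), so the compensator increment is `J = ∫₀ʰ m(B_r) dr` with
`0 ≤ J ≤ h · massBound δ₀ ρ₀` and `|J − h m(B)| ≤ h · massStepC δ₀ ρ₀ (h + η)` (`StarHullSubStep`,
`JFnK_concat_bounds`), and the conditional increment is the deterministic-hull expectation bounded in
`SLERestrictionOneStepKappa` (`abs_integral_sub_le_of_eqOn_goodK`).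

Also: the increment functional `JFnK κ A u h υ = ∫₀ʰ 𝟙{alive} m(A_{u+r} − W_{u+r}) dr` is a
measurable functional of the path (the shifted mass functional is right-continuous in time for every
path, hence progressive for the constant Borel filtration of path space; Fubini), nonnegative.

## References

* [LSW] Prop. 5.3 (§5). [LawlerSchrammWerner2003Restriction]
-/

noncomputable section

open Set Filter Metric Function MeasureTheory ProbabilityTheory
open _root_.Complex _root_.Topology
open Literature.Probability.Process (brownian preWienerMeasure runSup)
open Literature.Analysis.FunctionSpaces (timeIntegral)
open scoped NNReal

namespace Literature.Probability.RandomPlanarGeometry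

open Loewner PathOps

/-! ### The driver of a concatenated path -/

section Concat

variable {κ : ℝ≥0} {u : ℝ≥0}

/-- Up to time `u` the concatenated path has the driver of the first path. [folklore] -/
theorem drvK_concat_of_le (p q : C(ℝ≥0, ℝ)) {r : ℝ≥0} (hr : r ≤ u) :
    drvK κ (concat u (p, q)) r = drvK κ p r := by
  have h0 : concat u (p, q) 0 = p 0 := concat_apply_of_le u p q bot_le
  simp only [drvK, concat_apply_of_le u p q hr, h0]

/-- The increments after `u` of the driver of the concatenated path. [folklore] -/
theorem drvK_concat_add_sub (p q : C(ℝ≥0, ℝ)) (hq : q 0 = 0) (r : ℝ≥0) :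
    drvK κ (concat u (p, q)) (u + r) - drvK κ (concat u (p, q)) u = Real.sqrt κ * q r := by
  have h1 := concat_apply_add u p q hq r
  have h0 : concat u (p, q) u = p u := concat_apply_of_le u p q le_rfl
  simp only [drvK]
  rw [h1, h0]; ring

/-- The shifted driver of `concat_u(p, β(ω₂))` is the SLE_κ driver of `ω₂`. [folklore] -/
theorem shift_drvK_concat_brownianCPath (p : C(ℝ≥0, ℝ)) (ω₂ : ℝ≥0 → ℝ) :
    (fun r ↦ drvK κ (concat u (p, brownianCPath ω₂)) (u + r) - drvK κ (concat u (p, brownianCPath ω₂)) u) =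
      stepDriverK κ ω₂ := by
  funext r
  rw [drvK_concat_add_sub p _ (brownianCPath_zero ω₂), stepDriverK_apply, brownianCPath_apply]

end Concat

/-! ### The compensator increment along a path -/

section Functional

variable (κ : ℝ≥0) {A : Set ℂ}

/-- **The compensator increment `∫ᵤ^{u+h} 𝟙{alive} m(A_s − W_s) ds` along a path**, as the time
integral over `[0, h]` of the shifted mass functional. [cite: LawlerSchrammWerner2003Restriction, Prop. 5.3 (the compensator)] -/
def JFnK (A : Set ℂ) (u : ℝ≥0) : ℝ≥0 → C(ℝ≥0, ℝ) → ℝ := timeIntegral fun r υ ↦ MFnK κ A (u + r) υ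

variable {κ}

/-- Unfolding: `JFnK κ A u h υ = ∫₀ʰ MFnK κ A (u + r) υ dr`. [folklore] -/
theorem JFnK_eq (u h : ℝ≥0) (υ : C(ℝ≥0, ℝ)) :
    JFnK κ A u h υ = ∫ r in (0 : ℝ)..h, MFnK κ A (u + r.toNNReal) υ := rfl

/-- `JFnK ≥ 0` (the mass is nonnegative). [folklore] -/
theorem JFnK_nonneg (hA : IsStarHull A) (u h : ℝ≥0) (υ : C(ℝ≥0, ℝ)) : 0 ≤ JFnK κ A u h υ :=
  intervalIntegral.integral_nonneg h.coe_nonneg fun _ _ ↦ MFnK_nonneg hA _ _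

/-- The shifted mass functional is right-continuous in time, for every path. [folklore] -/
theorem continuousWithinAt_MFnK_shift (hA : IsStarHull A) (hne : A.Nonempty) (υ : C(ℝ≥0, ℝ)) (u r : ℝ≥0) :
    ContinuousWithinAt (fun r ↦ MFnK κ A (u + r) υ) (Ici r) r :=
  (continuousWithinAt_MFnK hA hne υ (u + r)).comp (continuous_const.add continuous_id).continuousWithinAt
    fun _ hx ↦ Set.mem_Ici.2 (add_le_add le_rfl hx)

variable [MeasurableSpace C(ℝ≥0, ℝ)] [BorelSpace C(ℝ≥0, ℝ)]

/-- The shifted mass functional is progressive for the constant (Borel) filtration of path space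
(measurable in the path at each time, right-continuous in time for each path). [folklore] -/
theorem isStronglyProgressive_MFnK_shift (hA : IsStarHull A) (hne : A.Nonempty) (u : ℝ≥0) :
    IsStronglyProgressive (Filtration.const ℝ≥0 ‹MeasurableSpace C(ℝ≥0, ℝ)› le_rfl)
      (fun r υ ↦ MFnK κ A (u + r) υ) :=
  Literature.Probability.Process.isStronglyProgressive_of_rightContinuous
    (fun r ↦ measurable_MFnK hA hne (u + r)) fun υ r ↦ continuousWithinAt_MFnK_shift hA hne υ u r

/-- **The compensator increment is a measurable functional of the path** (Fubini measurability of
the time integral of a progressive process). [folklore] -/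
theorem measurable_JFnK (hA : IsStarHull A) (hne : A.Nonempty) (u h : ℝ≥0) : Measurable (JFnK κ A u h) :=
  Literature.Analysis.FunctionSpaces.adapted_timeIntegral (isStronglyProgressive_MFnK_shift hA hne u) h

omit [BorelSpace C(ℝ≥0, ℝ)] in
/-- The shifted mass functional is measurable in time, for every path. [folklore] -/
theorem measurable_MFnK_shift_path [BorelSpace C(ℝ≥0, ℝ)] (hA : IsStarHull A) (hne : A.Nonempty) (u : ℝ≥0)
    (υ : C(ℝ≥0, ℝ)) : Measurable fun r : ℝ≥0 ↦ MFnK κ A (u + r) υ :=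
  (isStronglyProgressive_MFnK_shift hA hne u).measurable_path υ

end Functional

/-! ### Identification of the frozen step at every intermediate time, on the good event -/

section Frozen

variable {κ : ℝ≥0} (hκ : κ ≤ 8 / 3) {A : Set ℂ} (hA : IsStarHull A) {u h : ℝ≥0} {p : C(ℝ≥0, ℝ)} {δ₀ ρ₀ : ℝ}
  (halive : Disjoint (closedHull (drvK κ p) u) A) (hρ₀ : 0 < ρ₀)
  (hBρ : Disjoint (ball (0 : ℂ) (16 * ρ₀)) (slidHull (drvK κ p) A u))
  (hδ0 : 0 < δ₀) (hδ : 2 * δ₀ ≤ starDeriv (slidHull (drvK κ p) A u)) (hh0 : 0 < h)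
  (hh : (h : ℝ) ≤ (δ₀ * ρ₀ / 4000) ^ 2 / 32)

include hδ in
/-- `δ₀ ≤ 1` (as `Φ′ ≤ 1`). [folklore] -/
theorem frozen_delta_le_one : δ₀ ≤ 1 := by
  have := (starDeriv_pos_le_one (slidHull (drvK κ p) A u)).2
  linarith

include hκ hA halive hρ₀ hBρ hδ0 hδ hh in
/-- **On the good event, at every intermediate time `u + r`, `0 < r ≤ h`, the hulls of the frozen path
`υ = concat_u(stop_u p, β(ω₂))` have not reached `A`, and `A_{u+r} − W_{u+r}` is the one-step image of
`B = A_u − W_u` under the fresh driver `√κ B(ω₂)`.** [cite: LawlerSchrammWerner2003Restriction, §5] -/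
theorem frozen_subStepK {ω₂ : ℝ≥0 → ℝ} (hω₂ : ω₂ ∈ goodEvent δ₀ ρ₀ h) {r : ℝ≥0} (hr0 : 0 < r) (hrh : r ≤ h) :
    Disjoint (closedHull (drvK κ (concat u (stop u p, brownianCPath ω₂))) (u + r)) A ∧
      slidHull (drvK κ (concat u (stop u p, brownianCPath ω₂))) A (u + r) =
        slidHull (stepDriverK κ ω₂) (slidHull (drvK κ p) A u) r := by
  set υ := concat u (stop u p, brownianCPath ω₂) with hυ
  have hW := continuous_drvK κ p
  have hW' := continuous_drvK κ υ
  have heq : ∀ s, s ≤ u → drvK κ p s = drvK κ υ s := fun s hs ↦ by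
    rw [hυ, drvK_concat_of_le _ _ hs, drvK_stop_of_le κ p hs]
  -- locality at time `u`
  have hcl : closedHull (drvK κ υ) u = closedHull (drvK κ p) u := (closedHull_eq_of_eqOn hW hW' heq).symm
  have halive' : Disjoint (closedHull (drvK κ υ) u) A := by rw [hcl]; exact halive
  have hAalive : ∀ a ∈ A, (u : WithTop ℝ≥0) < swallowingTime (drvK κ p) a := fun a ha ↦
    lt_swallowingTime_of_alive hA halive ha
  have hsl : slidHull (drvK κ υ) A u = slidHull (drvK κ p) A u := slidHull_eq_of_eqOn hW hW' heq hAalive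
  have hBρ8 : Disjoint (ball (0 : ℂ) (8 * ρ₀)) (slidHull (drvK κ υ) A u) := by
    rw [hsl]; exact hBρ.mono_left (ball_subset_ball (by linarith))
  -- the shifted driver and its oscillation on the good event
  have hshift : (fun r ↦ drvK κ υ (u + r) - drvK κ υ u) = stepDriverK κ ω₂ := shift_drvK_concat_brownianCPath (stop u p) ω₂
  obtain ⟨h4, h2c, hh4⟩ := frozen_smallness hρ₀ hδ0 (frozen_delta_le_one hδ) hh
  have hω₂' : stepSigma * runSup h ω₂ ≤ δ₀ * ρ₀ / 4000 := hω₂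
  have hS : ∀ r' : ℝ≥0, r' ≤ r → |drvK κ υ (u + r') - drvK κ υ u| ≤ stepSigma * runSup h ω₂ := fun r' hr' ↦ by
    have := congrFun hshift r'
    rw [this]; exact abs_stepDriverK_le hκ (hr'.trans hrh) ω₂
  have hη : stepSize (stepSigma * runSup h ω₂) r ≤ ρ₀ := by
    refine (stepSize_mono _ hrh).trans ?_
    rw [stepSize]; linarith
  have hr4 : (r : ℝ) ≤ (ρ₀ / 4) ^ 2 := (NNReal.coe_le_coe.2 hrh).trans hh4
  refine ⟨disjoint_closedHull_add hW' hA halive' hρ₀ hBρ8 hr0 hS hη hr4, ?_⟩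
  have hadd := slidHull_add_eq hW' hA halive' hρ₀ hBρ8 hr0 hS hη hr4
  rw [hshift, hsl] at hadd
  exact hadd

include hκ hA halive hρ₀ hBρ hδ0 hδ hh0 hh in
/-- On the good event: `D_{u+h} 𝟙{alive} (υ) = Φ′(B_h)` and, at every `0 < r ≤ h`,
`(𝟙{alive} m)(u + r)(υ) = m(B_r)`, `B_r = slidHull (√κ B(ω₂)) (A_u − W_u) r`. [folklore] -/
theorem DFnK_MFnK_concat_eq_of_good {ω₂ : ℝ≥0 → ℝ} (hω₂ : ω₂ ∈ goodEvent δ₀ ρ₀ h) :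
    DFnK κ A (u + h) (concat u (stop u p, brownianCPath ω₂)) =
        starDeriv (slidHull (stepDriverK κ ω₂) (slidHull (drvK κ p) A u) h) ∧
      ∀ r : ℝ≥0, 0 < r → r ≤ h → MFnK κ A (u + r) (concat u (stop u p, brownianCPath ω₂)) =
        starBubbleMass (slidHull (stepDriverK κ ω₂) (slidHull (drvK κ p) A u) r) := by
  constructor
  · obtain ⟨hal, hsl⟩ := frozen_subStepK hκ hA halive hρ₀ hBρ hδ0 hδ hh hω₂ hh0 le_rfl
    rw [(DFnK_eq (κ := κ) (A := A) (u + h) _).1 hal, hsl]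
  · intro r hr0 hrh
    obtain ⟨hal, hsl⟩ := frozen_subStepK hκ hA halive hρ₀ hBρ hδ0 hδ hh hω₂ hr0 hrh
    rw [MFnK_of_alive hal, hsl]

include hκ hA halive hρ₀ hBρ hδ0 hδ hh0 hh in
/-- **The compensator increment of the frozen step on the good event**: `J = ∫₀ʰ m(B_r) dr` satisfies
`0 ≤ J ≤ h · massBound δ₀ ρ₀` and `|J − h m(B)| ≤ h · massStepC δ₀ ρ₀ (h + η)` (`StarHullSubStep`).
[cite: LawlerSchrammWerner2003Restriction, Prop. 5.3 (the compensator increment)] -/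
theorem JFnK_concat_bounds [MeasurableSpace C(ℝ≥0, ℝ)] [BorelSpace C(ℝ≥0, ℝ)] (hne : A.Nonempty)
    {ω₂ : ℝ≥0 → ℝ} (hω₂ : ω₂ ∈ goodEvent δ₀ ρ₀ h) :
    0 ≤ JFnK κ A u h (concat u (stop u p, brownianCPath ω₂)) ∧
      JFnK κ A u h (concat u (stop u p, brownianCPath ω₂)) ≤ h * massBound δ₀ ρ₀ ∧
      |JFnK κ A u h (concat u (stop u p, brownianCPath ω₂)) - h * starBubbleMass (slidHull (drvK κ p) A u)| ≤
        h * (massStepC δ₀ ρ₀ * (h + stepSize (stepSigma * runSup h ω₂) h)) := by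
  set υ := concat u (stop u p, brownianCPath ω₂) with hυ
  set B := slidHull (drvK κ p) A u with hB
  set S : ℝ := stepSigma * runSup h ω₂ with hSdef
  have hBstar : IsStarHull B := Loewner.isStarHull_slidHull_of_disjoint (continuous_drvK κ p) hA halive
  obtain ⟨hUc, hU0⟩ := continuous_stepDriverK κ ω₂
  have hSU : ∀ v : ℝ≥0, v ≤ h → |stepDriverK κ ω₂ v| ≤ S := fun v hv ↦ abs_stepDriverK_le hκ hv ω₂
  obtain ⟨h4, -, -⟩ := frozen_smallness hρ₀ hδ0 (frozen_delta_le_one hδ) hh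
  have hω₂' : S ≤ δ₀ * ρ₀ / 4000 := hω₂
  obtain ⟨hd0, hd1, -⟩ := starDeriv_spec hBstar
  have hη : stepSize S h ≤ starDeriv B * ρ₀ / 1000 := by
    rw [stepSize]
    have : δ₀ * ρ₀ / 2000 ≤ starDeriv B * ρ₀ / 1000 := by
      rw [div_le_div_iff₀ (by norm_num) (by norm_num)]; nlinarith [mul_pos hδ0 hρ₀]
    linarith
  -- the integrand on `(0, h]`
  set f : ℝ → ℝ := fun r ↦ MFnK κ A (u + r.toNNReal) υ with hf
  have hfr : ∀ r ∈ Ioc (0 : ℝ) h, f r = starBubbleMass (slidHull (stepDriverK κ ω₂) B r.toNNReal) ∧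
      0 ≤ f r ∧ f r ≤ massBound δ₀ ρ₀ ∧ |f r - starBubbleMass B| ≤ massStepC δ₀ ρ₀ * (h + stepSize S h) := by
    intro r hr
    have hr0 : 0 < r.toNNReal := Real.toNNReal_pos.2 hr.1
    have hrh : r.toNNReal ≤ h := Real.toNNReal_le_iff_le_coe.2 hr.2
    have heq : f r = starBubbleMass (slidHull (stepDriverK κ ω₂) B r.toNNReal) :=
      (DFnK_MFnK_concat_eq_of_good hκ hA halive hρ₀ hBρ hδ0 hδ hh0 hh hω₂).2 _ hr0 hrh
    obtain ⟨h0, hM, hΔ⟩ := subStep_mass_bounds hBstar hUc hU0 hSU hρ₀ hBρ hη hδ0 hδ hr0 hrh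
    exact ⟨heq, heq ▸ h0, heq ▸ hM, heq ▸ hΔ⟩
  have hJ : JFnK κ A u h υ = ∫ r in (0 : ℝ)..h, f r := rfl
  have hM0 : 0 ≤ massBound δ₀ ρ₀ := by rw [massBound]; positivity
  refine ⟨JFnK_nonneg hA u h υ, ?_, ?_⟩
  · -- `J ≤ h · massBound`
    have hb : ∀ r ∈ Set.uIoc (0 : ℝ) h, ‖f r‖ ≤ massBound δ₀ ρ₀ := fun r hr ↦ by
      rw [Set.uIoc_of_le h.coe_nonneg] at hr
      obtain ⟨-, h0, hM, -⟩ := hfr r hr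
      rw [Real.norm_eq_abs, abs_of_nonneg h0]; exact hM
    have hI0 : 0 ≤ ∫ r in (0 : ℝ)..h, f r := hJ ▸ JFnK_nonneg hA u h υ
    have := intervalIntegral.norm_integral_le_of_norm_le_const hb
    rw [sub_zero, abs_of_nonneg h.coe_nonneg, Real.norm_eq_abs, abs_of_nonneg hI0] at this
    rw [hJ]; linarith [this]
  · -- `|J - h m(B)| ≤ h · massStepC (h + η)`: integrability first
    have hfm : Measurable f := (measurable_MFnK_shift_path hA hne u υ).comp measurable_real_toNNReal
    have hfi : IntervalIntegrable f volume 0 h := by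
      rw [intervalIntegrable_iff_integrableOn_Ioc_of_le h.coe_nonneg]
      refine Measure.integrableOn_of_bounded (M := massBound δ₀ ρ₀) measure_Ioc_lt_top.ne hfm.aestronglyMeasurable ?_
      filter_upwards [ae_restrict_mem measurableSet_Ioc] with r hr
      obtain ⟨-, h0, hM, -⟩ := hfr r hr
      rw [Real.norm_eq_abs, abs_of_nonneg h0]; exact hM
    have hsplit : JFnK κ A u h υ - h * starBubbleMass B = ∫ r in (0 : ℝ)..h, (f r - starBubbleMass B) := by
      rw [intervalIntegral.integral_sub hfi intervalIntegrable_const, intervalIntegral.integral_const, hJ]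
      simp
    rw [hsplit]
    have hb : ∀ r ∈ Set.uIoc (0 : ℝ) h, ‖f r - starBubbleMass B‖ ≤ massStepC δ₀ ρ₀ * (h + stepSize S h) := fun r hr ↦ by
      rw [Set.uIoc_of_le h.coe_nonneg] at hr
      rw [Real.norm_eq_abs]; exact (hfr r hr).2.2.2
    have := intervalIntegral.norm_integral_le_of_norm_le_const hb
    rw [sub_zero, abs_of_nonneg h.coe_nonneg, Real.norm_eq_abs] at this
    linarith

end Frozen

/-! ### The conditional one-step bound -/

section Bound

variable [MeasurableSpace C(ℝ≥0, ℝ)] [BorelSpace C(ℝ≥0, ℝ)]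
variable {κ : ℝ≥0} {α lam : ℝ} (hκ0 : 0 < κ) (hκ : κ ≤ 8 / 3) (hαdef : α = (6 - κ) / (2 * κ))
  (hlamdef : lam = (8 - 3 * κ) * (6 - κ) / (2 * κ))
  {A : Set ℂ} (hA : IsStarHull A) (hne : A.Nonempty) {u h : ℝ≥0} {δ₀ ρ₀ : ℝ}
  (hρ₀ : 0 < ρ₀) (hρ1 : ρ₀ ≤ 1) (hδ0 : 0 < δ₀) (hh0 : 0 < h) (hh : (h : ℝ) ≤ (δ₀ * ρ₀ / 4000) ^ 2 / 32)
  (hlamh : lam * (h * massBound δ₀ ρ₀) ≤ 1)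

include hκ0 hκ hαdef hlamdef hA hne hρ₀ hρ1 hδ0 hh0 hh hlamh in
/-- **[LSW] Prop. 5.3 (`0 < κ ≤ 8/3`), conditional-increment form.** For an `𝓕_u`-measurable weight
`g : Ω → [0, 1]` supported where `A_u − W_u` is in the controlled class (`Φ′ ≥ 2δ₀`, `B(0, 16ρ₀)` off
the hull), `|E[g · (D̂_{u+h}^α e^{−λ ∫ᵤ^{u+h} m} − Φ′_{A_u − W_u}(0)^α)]| ≤ stepCK α λ δ₀ ρ₀ · h √h`,
`D̂_{u+h} = Φ′_{A_{u+h} − W_{u+h}}(0) 𝟙{alive}`, `∫ᵤ^{u+h} m = JFnK κ A u h`.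
[cite: LawlerSchrammWerner2003Restriction, Prop. 5.3] -/
theorem abs_integral_mul_sub_leK {g : (ℝ≥0 → ℝ) → ℝ} (hgm : Measurable[brownianFiltration u] g)
    (hg01 : ∀ ω, g ω ∈ Icc (0 : ℝ) 1)
    (hsupp : ∀ ω, g ω ≠ 0 → Disjoint (closedHull (drvK κ (brownianCPath ω)) u) A ∧
      Disjoint (ball (0 : ℂ) (16 * ρ₀)) (slidHull (drvK κ (brownianCPath ω)) A u) ∧
        2 * δ₀ ≤ starDeriv (slidHull (drvK κ (brownianCPath ω)) A u)) :
    |∫ ω, g ω * (DFnK κ A (u + h) (brownianCPath ω) ^ α *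
        Real.exp (-(lam * JFnK κ A u h (brownianCPath ω))) -
        starDeriv (slidHull (drvK κ (brownianCPath ω)) A u) ^ α) ∂preWienerMeasure| ≤
      stepCK α lam δ₀ ρ₀ * h * Real.sqrt h := by
  haveI := isProbabilityMeasure_preWienerMeasure'
  obtain ⟨hαpos, hlam0⟩ := exponents_pos hκ hαdef hlamdef hκ0
  set C₀ : ℝ := stepCK α lam δ₀ ρ₀ * h * Real.sqrt h with hC₀
  have hC₀0 : 0 ≤ C₀ := by rw [hC₀]; have := stepCK_nonneg hαpos hlam0 hδ0 hρ₀; positivity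
  -- Doob–Dynkin, clipped to `[0, 1]`
  obtain ⟨H, hHm, hgH⟩ := exists_eq_comp_stop (u := u) hgm
  set H' : C(ℝ≥0, ℝ) → ℝ := fun υ ↦ max 0 (min (H υ) 1) with hH'
  have hH'm : Measurable H' := measurable_const.max (hHm.min measurable_const)
  have hH'b : ∀ υ, |H' υ| ≤ 1 := fun υ ↦ by
    rw [abs_le]; exact ⟨by linarith [le_max_left 0 (min (H υ) 1)], max_le zero_le_one (min_le_right _ _)⟩
  have hgH' : ∀ ω, g ω = H' (stop u (brownianCPath ω)) := fun ω ↦ by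
    rw [hH']; simp only
    rw [← hgH ω, min_eq_left (hg01 ω).2, max_eq_right (hg01 ω).1]
  -- the functional `J = D̂_{u+h}^α e^{−λ ∫ m}`
  set J : C(ℝ≥0, ℝ) → ℝ := fun υ ↦ DFnK κ A (u + h) υ ^ α * Real.exp (-(lam * JFnK κ A u h υ)) with hJ
  have hJm : Measurable J :=
    ((measurable_DFnK hA hne (u + h)).pow_const _).mul ((measurable_JFnK hA hne u h).const_mul lam).neg.exp
  have hJ01 : ∀ υ, J υ ∈ Icc (0 : ℝ) 1 := fun υ ↦ by
    obtain ⟨-, -, h0, h1⟩ := DFnK_eq (κ := κ) (A := A) (u + h) υ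
    have e0 : 0 ≤ DFnK κ A (u + h) υ ^ α := Real.rpow_nonneg h0 _
    have e1 : DFnK κ A (u + h) υ ^ α ≤ 1 := Real.rpow_le_one h0 h1 hαpos.le
    have c0 : 0 < Real.exp (-(lam * JFnK κ A u h υ)) := Real.exp_pos _
    have c1 : Real.exp (-(lam * JFnK κ A u h υ)) ≤ 1 := by
      rw [Real.exp_le_one_iff, neg_nonpos]; exact mul_nonneg hlam0 (JFnK_nonneg hA u h υ)
    exact ⟨mul_nonneg e0 c0.le, mul_le_one₀ e1 c0.le c1⟩
  have hJb : ∀ υ, |J υ| ≤ 1 := fun υ ↦ by rw [abs_of_nonneg (hJ01 υ).1]; exact (hJ01 υ).2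
  -- freezing
  have hfreeze := integral_mul_eq_integral_integral_concat u hH'm hJm hH'b hJb
  set Θ : (ℝ≥0 → ℝ) → ℝ := fun ω ↦ ∫ ω₂, J (concat u (stop u (brownianCPath ω), brownianCPath ω₂)) ∂preWienerMeasure with hΘ
  set Y : (ℝ≥0 → ℝ) → ℝ := fun ω ↦ starDeriv (slidHull (drvK κ (brownianCPath ω)) A u) ^ α with hY
  -- measurability and bounds
  have hgm' : Measurable g := hgm.mono (brownianFiltration.le u) le_rfl
  have hXm : Measurable fun ω ↦ stop u (brownianCPath ω) := (measurable_stop u).comp measurable_brownianCPath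
  have hJβ : Measurable fun ω ↦ J (brownianCPath ω) := hJm.comp measurable_brownianCPath
  have hΘm : Measurable Θ := by
    have h2 : Measurable fun q : (ℝ≥0 → ℝ) × (ℝ≥0 → ℝ) ↦ J (concat u (stop u (brownianCPath q.1), brownianCPath q.2)) :=
      hJm.comp ((measurable_concat u).comp ((hXm.comp measurable_fst).prodMk (measurable_brownianCPath.comp measurable_snd)))
    exact h2.stronglyMeasurable.integral_prod_right' |>.measurable
  have hΘ01 : ∀ ω, Θ ω ∈ Icc (0 : ℝ) 1 := fun ω ↦ by
    constructor
    · exact integral_nonneg fun ω₂ ↦ (hJ01 _).1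
    · have := integral_mono (μ := preWienerMeasure) (f := fun ω₂ ↦ J (concat u (stop u (brownianCPath ω), brownianCPath ω₂)))
        (g := fun _ ↦ (1 : ℝ)) ?_ (integrable_const _) fun ω₂ ↦ (hJ01 _).2
      · simpa using this
      · exact (integrable_const (1 : ℝ)).mono' ((hJm.comp ((measurable_concat u).comp
          (measurable_const.prodMk measurable_brownianCPath))).aestronglyMeasurable)
          (Eventually.of_forall fun ω₂ ↦ by rw [Real.norm_eq_abs]; exact hJb _)
  have hY01 : ∀ ω, Y ω ∈ Icc (0 : ℝ) 1 := fun ω ↦ by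
    obtain ⟨h0, h1⟩ := starDeriv_pos_le_one (slidHull (drvK κ (brownianCPath ω)) A u)
    exact ⟨Real.rpow_nonneg h0.le _, Real.rpow_le_one h0.le h1 hαpos.le⟩
  have hYm : Measurable fun ω ↦ g ω * Y ω := by
    have h1 : (fun ω ↦ g ω * Y ω) = fun ω ↦ g ω * DFnK κ A u (brownianCPath ω) ^ α := by
      funext ω
      by_cases hg0 : g ω = 0
      · rw [hg0, zero_mul, zero_mul]
      · rw [hY]; simp only
        rw [(DFnK_eq (κ := κ) (A := A) u (brownianCPath ω)).1 (hsupp ω hg0).1]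
    rw [h1]
    exact hgm'.mul (((measurable_DFnK hA hne u).comp measurable_brownianCPath).pow_const _)
  have hbdd_int : ∀ {f : (ℝ≥0 → ℝ) → ℝ}, Measurable f → (∀ ω, |f ω| ≤ 1) → Integrable f preWienerMeasure := fun hf hb ↦
    (integrable_const (1 : ℝ)).mono' hf.aestronglyMeasurable (Eventually.of_forall fun ω ↦ by rw [Real.norm_eq_abs]; exact hb ω)
  have hg1 : ∀ ω, |g ω| ≤ 1 := fun ω ↦ by rw [abs_of_nonneg (hg01 ω).1]; exact (hg01 ω).2
  have i1 : Integrable (fun ω ↦ g ω * J (brownianCPath ω)) preWienerMeasure :=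
    hbdd_int (hgm'.mul hJβ) fun ω ↦ by rw [abs_mul]; exact mul_le_one₀ (hg1 ω) (abs_nonneg _) (hJb _)
  have i2 : Integrable (fun ω ↦ g ω * Y ω) preWienerMeasure :=
    hbdd_int hYm fun ω ↦ by
      rw [abs_mul, abs_of_nonneg (hY01 ω).1]; exact mul_le_one₀ (hg1 ω) (hY01 ω).1 (hY01 ω).2
  have i3 : Integrable (fun ω ↦ g ω * Θ ω) preWienerMeasure :=
    hbdd_int (hgm'.mul hΘm) fun ω ↦ by
      rw [abs_mul, abs_of_nonneg (hΘ01 ω).1]; exact mul_le_one₀ (hg1 ω) (hΘ01 ω).1 (hΘ01 ω).2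
  -- rewrite the integral through the freezing formula
  have hsplit : ∫ ω, g ω * (DFnK κ A (u + h) (brownianCPath ω) ^ α *
      Real.exp (-(lam * JFnK κ A u h (brownianCPath ω))) -
      starDeriv (slidHull (drvK κ (brownianCPath ω)) A u) ^ α) ∂preWienerMeasure =
      ∫ ω, g ω * (Θ ω - Y ω) ∂preWienerMeasure := by
    have e1 : (fun ω ↦ g ω * (DFnK κ A (u + h) (brownianCPath ω) ^ α *
        Real.exp (-(lam * JFnK κ A u h (brownianCPath ω))) -
        starDeriv (slidHull (drvK κ (brownianCPath ω)) A u) ^ α)) =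
        fun ω ↦ g ω * J (brownianCPath ω) - g ω * Y ω := by
      funext ω; rw [hJ, hY]; ring
    have e2 : (fun ω ↦ g ω * (Θ ω - Y ω)) = fun ω ↦ g ω * Θ ω - g ω * Y ω := by funext ω; ring
    rw [e1, e2, integral_sub i1 i2, integral_sub i3 i2]
    congr 1
    have e3 : (fun ω ↦ g ω * J (brownianCPath ω)) = fun ω ↦ H' (stop u (brownianCPath ω)) * J (brownianCPath ω) := by
      funext ω; rw [hgH' ω]
    have e4 : (fun ω ↦ g ω * Θ ω) = fun ω ↦ H' (stop u (brownianCPath ω)) * Θ ω := by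
      funext ω; rw [hgH' ω]
    rw [e3, e4]
    exact hfreeze
  rw [hsplit]
  -- pointwise bound by the deterministic one-step estimate
  have hpt : ∀ ω, |g ω * (Θ ω - Y ω)| ≤ C₀ := fun ω ↦ by
    by_cases hg0 : g ω = 0
    · rw [hg0, zero_mul, abs_zero]; exact hC₀0
    · obtain ⟨halive, hBρ, hδ⟩ := hsupp ω hg0
      set B := slidHull (drvK κ (brownianCPath ω)) A u with hBdef
      have hB := Loewner.isStarHull_slidHull_of_disjoint (continuous_drvK κ _) hA halive
      have hBρ8 : Disjoint (ball (0 : ℂ) (8 * ρ₀)) B := hBρ.mono_left (ball_subset_ball (by linarith))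
      have hδ' : δ₀ ≤ starDeriv B := by linarith
      have hZm : Measurable fun ω₂ ↦ J (concat u (stop u (brownianCPath ω), brownianCPath ω₂)) :=
        hJm.comp ((measurable_concat u).comp (measurable_const.prodMk measurable_brownianCPath))
      have hZeq : ∀ ω₂ ∈ goodEvent δ₀ ρ₀ h, ∃ Jv : ℝ, 0 ≤ Jv ∧ Jv ≤ h * massBound δ₀ ρ₀ ∧
          |Jv - h * bubbleMass (starDeriv B) (starJet2 B / 2) (starJet3 B / 6)| ≤
            h * (massStepC δ₀ ρ₀ * (h + stepSize (stepSigma * runSup h ω₂) h)) ∧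
          J (concat u (stop u (brownianCPath ω), brownianCPath ω₂)) =
            starDeriv (slidHull (stepDriverK κ ω₂) B h) ^ α * Real.exp (-(lam * Jv)) := by
        intro ω₂ hω₂
        refine ⟨JFnK κ A u h (concat u (stop u (brownianCPath ω), brownianCPath ω₂)), ?_⟩
        obtain ⟨hJ0, hJM, hJΔ⟩ := JFnK_concat_bounds hκ hA halive hρ₀ hBρ hδ0 hδ hh0 hh hne hω₂
        refine ⟨hJ0, hJM, hJΔ, ?_⟩
        rw [hJ]; simp only
        rw [(DFnK_MFnK_concat_eq_of_good hκ hA halive hρ₀ hBρ hδ0 hδ hh0 hh hω₂).1]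
      have key := abs_integral_sub_le_of_eqOn_goodK hκ0 hκ hαdef hlamdef hB hρ₀ hρ1 hBρ8 hδ0 hδ' hh0 hh hlamh
        hZm (fun ω₂ ↦ hJ01 _) hZeq
      rw [abs_mul]
      calc |g ω| * |Θ ω - Y ω| ≤ 1 * C₀ := mul_le_mul (hg1 ω) key (abs_nonneg _) zero_le_one
        _ = C₀ := one_mul _
  calc |∫ ω, g ω * (Θ ω - Y ω) ∂preWienerMeasure| ≤ ∫ ω, |g ω * (Θ ω - Y ω)| ∂preWienerMeasure := abs_integral_le_integral_abs
    _ ≤ ∫ _, C₀ ∂preWienerMeasure := integral_mono ((i3.sub i2).congr (Eventually.of_forall fun ω ↦ by simp only [Pi.sub_apply]; ring)).abs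
        (integrable_const _) hpt
    _ = C₀ := by simp

end Bound

end Literature.Probability.RandomPlanarGeometry

end
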